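import Summits.KontsevichZagierPeriods.KontsevichZagierPeriods.Theorems.SoloInformedAnEval
import Summits.KontsevichZagierPeriods.KontsevichZagierPeriods.Theorems.SoloInformedAlgPderiv
import Literature.Analysis.Calculus.ImplicitChart
import Mathlib.Analysis.Analytic.Order
import Mathlib.Analysis.Analytic.IsolatedZeros
import Mathlib.Data.Prod.Lex
import HarnessLib

/-!
# The DEN-calculus over `K`: the termination measure of the vertex-germ induction

Solo programme `solo-KontsevichZagierPeriods-informed`, session s107, step (x-p) of the general
two-dimensional algorithm.  For `F ∈ K[x₀, x₁]` of multiplicity `m` at `0` let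
`h := ∂₁^{m-1} F` be the **maximal-contact polynomial**.  If `∂h/∂x₁(0) ≠ 0`, the zero set of `h`
near `0` is the graph of an analytic implicit function `φ` (the maximal-contact curve), and

  `ν(F) := (ord₀ F(x, φ x), ord₀ φ) ∈ ℕ∞ ×ₗ ℕ∞`;

otherwise `ν(F) := (0, 0)`.  The **termination measure** is
`μ(F) := (m, ν(F) or ν(swap F) or ⊥) ∈ ℕ ×ₗ (ℕ∞ ×ₗ ℕ∞)`, branching on whether the pure
`x₁^m` / `x₀^m` coefficient of `F` is non-zero.  This file defines these objects and proves the
**branch independence** of `ν`: any continuous `ψ` with `ψ 0 = 0` and `h(x, ψ x) = 0` near `0`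
computes `ν(F)`, together with the existence of such a branch which is analytic and whose
derivative at `0` is determined by the linear part of `h`.

References: J. Kollár, *Lectures on Resolution of Singularities* (2007), §1.10 (maximal contact).
-/

noncomputable section

open scoped BigOperators Topology ContDiff
open Filter Polynomial

namespace Summit.KontsevichZagierPeriods.KontsevichZagierPeriods.Theorems

variable {K : Type*} [Field K] [Algebra K ℝ]

/-! ### The maximal-contact polynomial and the measure -/

/-- The maximal-contact polynomial `∂₁^{m-1} F`, `m` the multiplicity of `F` at `0`. [this work] -/
def soloInformedMaxContactK (F : MvPolynomial (Fin 2) K) : MvPolynomial (Fin 2) K :=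
  (MvPolynomial.pderiv 1)^[soloInformedMultK F - 1] F

/-- The invertibility condition of the implicit function theorem for the maximal-contact
polynomial at the origin. [this work] -/
def SoloInformedContactOK (F : MvPolynomial (Fin 2) K) : Prop :=
  (fderiv ℝ (soloInformedEvalR (soloInformedMaxContactK F)) ((0 : ℝ), (0 : ℝ)) ∘L
    ContinuousLinearMap.inr ℝ ℝ ℝ).IsInvertible

/-- The maximal-contact polynomial is analytic (as needed by the implicit function theorem).
[this work] -/
theorem soloInformed_contDiffAt_maxContactK (F : MvPolynomial (Fin 2) K) :
    ContDiffAt ℝ ω (soloInformedEvalR (soloInformedMaxContactK F)) ((0 : ℝ), (0 : ℝ)) :=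
  (soloInformed_analyticAt_evalR _ _).contDiffAt

/-- The maximal-contact curve: the implicit function of `h(x, y) = h(0, 0)` at the origin.
[this work] -/
def soloInformedContactCurveK (F : MvPolynomial (Fin 2) K) (H : SoloInformedContactOK F) : ℝ → ℝ :=
  (soloInformed_contDiffAt_maxContactK F).implicitFunction
    Literature.Analysis.Calculus.omega_ne_zero H

open Classical in
/-- **The secondary measure** `ν(F) = (ord₀ F(x, φ x), ord₀ φ)` along the maximal-contact curve
`φ` (and `(0, 0)` if there is none). [this work] -/
def soloInformedNuK (F : MvPolynomial (Fin 2) K) : ℕ∞ ×ₗ ℕ∞ :=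
  if H : SoloInformedContactOK F then
    toLex (analyticOrderAt (fun x => soloInformedEvalR F (x, soloInformedContactCurveK F H x)) 0,
      analyticOrderAt (soloInformedContactCurveK F H) 0)
  else toLex (0, 0)

/-- The pure `x₁^m` coefficient of `F`, `m` the multiplicity. [this work] -/
def soloInformedTopCoeffK (F : MvPolynomial (Fin 2) K) : K :=
  MvPolynomial.coeff (Finsupp.single 1 (soloInformedMultK F)) F

open Classical in
/-- **The termination measure** `μ(F) = (mult F, ν(F) | ν(swap F) | ⊥)`. [this work] -/
def soloInformedMuK (F : MvPolynomial (Fin 2) K) : ℕ ×ₗ (ℕ∞ ×ₗ ℕ∞) :=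
  toLex (soloInformedMultK F,
    if soloInformedTopCoeffK F ≠ 0 then soloInformedNuK F
    else if soloInformedTopCoeffK (soloInformedSwapK F) ≠ 0 then soloInformedNuK (soloInformedSwapK F)
    else toLex (0, 0))

/-- The measure takes values in a well-ordered type. [this work] -/
theorem soloInformed_wellFoundedLT_measure : WellFoundedLT (ℕ ×ₗ (ℕ∞ ×ₗ ℕ∞)) := inferInstance

/-! ### Values at the origin -/

/-- The value at `(0, 0)` is the constant coefficient. [this work] -/
theorem soloInformed_evalR_zero_zero (P : MvPolynomial (Fin 2) K) :
    soloInformedEvalR P ((0 : ℝ), (0 : ℝ)) = algebraMap K ℝ (MvPolynomial.coeff 0 P) :=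
  soloInformed_evalR_zero P

omit [Algebra K ℝ] in
/-- The maximal-contact polynomial of an `F` of multiplicity `k + 1` is `∂₁^k F`. [this work] -/
theorem soloInformed_maxContactK_eq {F : MvPolynomial (Fin 2) K} {k : ℕ}
    (h : soloInformedMultK F = k + 1) :
    soloInformedMaxContactK F = (MvPolynomial.pderiv 1)^[k] F := by
  rw [soloInformedMaxContactK, h, Nat.add_sub_cancel]

/-- The maximal-contact polynomial vanishes at the origin (multiplicity `≥ 1`). [this work] -/
theorem soloInformed_evalR_maxContactK_zero {F : MvPolynomial (Fin 2) K} {k : ℕ}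
    (h : soloInformedMultK F = k + 1) :
    soloInformedEvalR (soloInformedMaxContactK F) ((0 : ℝ), (0 : ℝ)) = 0 := by
  rw [soloInformed_evalR_zero_zero, soloInformed_maxContactK_eq h,
    soloInformed_coeff_zero_iterate_pderiv (soloInformed_le_deg_of_multK_eq h), map_zero]

/-- The contact condition holds iff... (sufficient direction): a non-zero `x₁`-coefficient of the
maximal-contact polynomial. [this work] -/
theorem soloInformed_contactOK_of_coeff {F : MvPolynomial (Fin 2) K}
    (h : MvPolynomial.coeff (Finsupp.single 1 1) (soloInformedMaxContactK F) ≠ 0) :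
    SoloInformedContactOK F :=
  soloInformed_isInvertible_fderiv_evalR_inr_zero _ h

/-! ### Branch independence of `ν` -/

/-- **Branch independence.**  If the maximal-contact polynomial `h` vanishes at `0` and `ψ` is a
continuous branch of `h = 0` through the origin, then `ν(F) = (ord₀ F(x, ψ x), ord₀ ψ)`.
[this work] -/
theorem soloInformed_nuK_eq_of_branch {F : MvPolynomial (Fin 2) K} (H : SoloInformedContactOK F)
    (h0 : soloInformedEvalR (soloInformedMaxContactK F) ((0 : ℝ), (0 : ℝ)) = 0) {ψ : ℝ → ℝ}
    (hψ0 : ψ 0 = 0) (hψc : ContinuousAt ψ 0)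
    (hψ : ∀ᶠ x in 𝓝 0, soloInformedEvalR (soloInformedMaxContactK F) (x, ψ x) = 0) :
    soloInformedNuK F =
      toLex (analyticOrderAt (fun x => soloInformedEvalR F (x, ψ x)) 0, analyticOrderAt ψ 0) := by
  unfold soloInformedNuK
  rw [dif_pos H]
  set φ := soloInformedContactCurveK F H with hφ
  have huniq := (soloInformed_contDiffAt_maxContactK F).eventually_apply_eq_iff_implicitFunction
    Literature.Analysis.Calculus.omega_ne_zero H
  have htend : Tendsto (fun x : ℝ => (x, ψ x)) (𝓝 0) (𝓝 ((0 : ℝ), (0 : ℝ))) := by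
    have h := (continuous_id.continuousAt (x := (0 : ℝ))).prodMk hψc
    rwa [ContinuousAt, id, hψ0] at h
  have hev : ∀ᶠ x in 𝓝 (0 : ℝ), φ x = ψ x := by
    filter_upwards [htend.eventually huniq, hψ] with x hx hx'
    rw [h0] at hx
    exact hx.1 hx'
  have h1 : analyticOrderAt (fun x => soloInformedEvalR F (x, φ x)) 0 =
      analyticOrderAt (fun x => soloInformedEvalR F (x, ψ x)) 0 :=
    analyticOrderAt_congr (hev.mono fun x hx => by simp only [hx])
  rw [h1, analyticOrderAt_congr hev]

/-- **The maximal-contact curve exists**: an analytic branch `φ` of `h = 0` through the origin,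
whose derivative `d = φ'(0)` satisfies `∂₀h(0) + d ∂₁h(0) = 0`, computing `ν(F)`. [this work] -/
theorem soloInformed_exists_contactCurve {F : MvPolynomial (Fin 2) K} (H : SoloInformedContactOK F)
    (h0 : soloInformedEvalR (soloInformedMaxContactK F) ((0 : ℝ), (0 : ℝ)) = 0) :
    ∃ φ : ℝ → ℝ, AnalyticAt ℝ φ 0 ∧ φ 0 = 0 ∧
      (∀ᶠ x in 𝓝 0, soloInformedEvalR (soloInformedMaxContactK F) (x, φ x) = 0) ∧
      algebraMap K ℝ (MvPolynomial.coeff (Finsupp.single 0 1) (soloInformedMaxContactK F)) +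
        deriv φ 0 * algebraMap K ℝ
          (MvPolynomial.coeff (Finsupp.single 1 1) (soloInformedMaxContactK F)) = 0 ∧
      soloInformedNuK F =
        toLex (analyticOrderAt (fun x => soloInformedEvalR F (x, φ x)) 0, analyticOrderAt φ 0) := by
  set h := soloInformedMaxContactK F with hh
  set cdf := soloInformed_contDiffAt_maxContactK F
  set φ := soloInformedContactCurveK F H with hφ
  have han : AnalyticAt ℝ φ 0 :=
    Literature.Analysis.Calculus.analyticAt_implicitFunction cdf H
  have hφ0 : φ 0 = 0 := cdf.implicitFunction_apply_self Literature.Analysis.Calculus.omega_ne_zero H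
  have hev : ∀ᶠ x in 𝓝 0, soloInformedEvalR h (x, φ x) = 0 := by
    have h' := cdf.eventually_apply_implicitFunction Literature.Analysis.Calculus.omega_ne_zero H
    rw [h0] at h'
    exact h'
  refine ⟨φ, han, hφ0, hev, ?_, ?_⟩
  · -- differentiate `x ↦ h (x, φ x)`, which vanishes near `0`
    have hφ' : HasDerivAt φ (deriv φ 0) 0 := han.differentiableAt.hasDerivAt
    have hF : HasFDerivAt (soloInformedEvalR h) (fderiv ℝ (soloInformedEvalR h) ((0 : ℝ), (0 : ℝ)))
        ((0 : ℝ), φ 0) := by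
      rw [hφ0]; exact (soloInformed_analyticAt_evalR h _).differentiableAt.hasFDerivAt
    have hcomp := hF.comp_hasDerivAt (0 : ℝ) ((hasDerivAt_id (0 : ℝ)).prodMk hφ')
    have hzero : HasDerivAt (fun x => soloInformedEvalR h (x, φ x)) 0 0 :=
      (hasDerivAt_const (0 : ℝ) (0 : ℝ)).congr_of_eventuallyEq hev
    have huq := hcomp.unique hzero
    rw [soloInformed_fderiv_evalR_apply, one_mul] at huq
    have e0 : soloInformedEvalR (MvPolynomial.pderiv 0 h) ((0 : ℝ), (0 : ℝ)) =
        algebraMap K ℝ (MvPolynomial.coeff (Finsupp.single 0 1) h) :=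
      soloInformed_evalR_pderiv_zero h 0
    have e1 : soloInformedEvalR (MvPolynomial.pderiv 1 h) ((0 : ℝ), (0 : ℝ)) =
        algebraMap K ℝ (MvPolynomial.coeff (Finsupp.single 1 1) h) :=
      soloInformed_evalR_pderiv_zero h 1
    rw [e0, e1] at huq
    exact huq
  · unfold soloInformedNuK
    rw [dif_pos H]

/-! ### The factorisation `φ = x · φ₁` -/

/-- An analytic germ vanishing at `0` factors as `x · φ₁(x)` with `φ₁ = dslope φ 0` analytic and
`φ₁(0) = φ'(0)`. [this work] -/
theorem soloInformed_dslope_spec {φ : ℝ → ℝ} (hφ : AnalyticAt ℝ φ 0) (h0 : φ 0 = 0) :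
    AnalyticAt ℝ (dslope φ 0) 0 ∧ (∀ x, φ x = x * dslope φ 0 x) ∧ dslope φ 0 0 = deriv φ 0 := by
  obtain ⟨p, hp⟩ := hφ
  refine ⟨⟨_, hp.has_fpower_series_dslope_fslope⟩, fun x => ?_, dslope_same φ 0⟩
  have h := sub_smul_dslope φ 0 x
  rw [sub_zero, smul_eq_mul, h0, sub_zero] at h
  exact h.symm

end Summit.KontsevichZagierPeriods.KontsevichZagierPeriods.Theorems
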